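import Mathlib
import Summits.Ventures.HodgeRepro2.T5HaarDoubleCosetVolume
import Summits.Ventures.HodgeRepro2.T5HeckeConvolution

/-!
# The Haar integral of `K`-invariant functions is a sum over `G/K`

For a left-invariant measure `μ` on `G` and a measurable subgroup `K` of finite measure, a
function `f = F ∘ (G → G/K)` that is right-`K`-invariant with finite support modulo `K`
(`F : G/K → 𝕜` finitely supported) has Bochner integral

  `∫_G f dμ = μ(K) · Σ_{xK ∈ G/K} F(xK)`

(`integral_comp_mk`): `f` is the finite sum of the constants `F(xK)` on the disjoint translates
`xK`, each of measure `μ(K)`.  Consequently (`haarConv_coeff_comp_mk`) the Haar convolution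

  `(f₁ ⋆ f₂)(x) = ∫_G f₁(y) f₂(y⁻¹x) dμ(y)`

of two `K`-bi-invariant functions `f₁ = s ∘ mk`, `f₂ = t ∘ mk` (with `s, t ∈ k[G/K]`, `t`
`K`-invariant) is `μ(K)` times the counting convolution `conv t s` of `T5HeckeConvolution`:

  `(f₁ ⋆ f₂)(x) = μ(K) · (conv t s)(xK)`.

With the normalisation `μ(K) = 1` the printed Hecke algebra `(C_c(K∖G/K), ⋆_Haar)` is therefore
the algebra `k[G/K]^K` with the product `conv` — i.e. `End_G(k[G/K])` of
`T5HeckePermutationModule`, the composition `T ∘ S` corresponding to `(S δ_K) ⋆ (T δ_K)`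
(`T5HeckeConvolution.mul_apply_single_one_eq_conv`; the order is the usual one for a right
module).  The characteristic function of a double coset has integral `#(KgK/K) · μ(K)`
(`integral_indicator_doubleCosetSet`).
-/

namespace Summit.Ventures.HodgeRepro2.T5HaarCosetIntegral

open MeasureTheory T5HaarDoubleCosetVolume T5HeckeConvolution LevelPositivity

section LeftInvariant

variable {G : Type*} [Group G] [MeasurableSpace G] [MeasurableMul G]
  {𝕜 : Type*} [RCLike 𝕜] (μ : Measure G) [μ.IsMulLeftInvariant]

omit [MeasurableSpace G] [MeasurableMul G] in
/-- A function `F ∘ mk` on `G` with `F` supported in a finite set `S ⊆ G/K` is the finite sum of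
the constants `F q` on the fibres `mk⁻¹{q}`, `q ∈ S`. -/
theorem comp_mk_eq_sum_indicator {K : Subgroup G} (F : G ⧸ K → 𝕜) {S : Finset (G ⧸ K)}
    (hS : Function.support F ⊆ S) (y : G) :
    F (QuotientGroup.mk y) =
      ∑ q ∈ S, ((QuotientGroup.mk : G → G ⧸ K) ⁻¹' {q}).indicator (fun _ => F q) y := by
  classical
  have h : ∀ q ∈ S, ((QuotientGroup.mk : G → G ⧸ K) ⁻¹' {q}).indicator (fun _ => F q) y =
      if q = QuotientGroup.mk y then F q else 0 := by
    intro q _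
    rw [Set.indicator_apply]
    simp only [Set.mem_preimage, Set.mem_singleton_iff]
    by_cases hq : (QuotientGroup.mk y : G ⧸ K) = q
    · rw [if_pos hq, if_pos hq.symm]
    · rw [if_neg hq, if_neg (Ne.symm hq)]
  rw [Finset.sum_congr rfl h, Finset.sum_ite_eq']
  by_cases hy : (QuotientGroup.mk y : G ⧸ K) ∈ S
  · rw [if_pos hy]
  · rw [if_neg hy]
    exact Function.support_subset_iff'.1 hS _ hy

/-- Each term `F q · 1_{mk⁻¹{q}}` is integrable when `K` is measurable of finite measure. -/
theorem integrable_indicator_preimage_mk {K : Subgroup G} (hK : MeasurableSet (K : Set G))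
    (hμ : μ K ≠ ⊤) (c : 𝕜) (q : G ⧸ K) :
    Integrable (((QuotientGroup.mk : G → G ⧸ K) ⁻¹' {q}).indicator fun _ => c) μ := by
  rw [integrable_indicator_iff (measurableSet_preimage_mk_singleton hK q)]
  refine integrableOn_const ?_
  rw [measure_preimage_mk_singleton μ K q]
  exact hμ

/-- THE HAAR INTEGRAL OF A `K`-INVARIANT FUNCTION IS A SUM OVER `G/K`:
`∫_G F(mk y) dμ(y) = μ(K) · Σ_{q ∈ S} F q` for `F` supported in the finite set `S`, `K` measurable
of finite measure. -/
theorem integral_comp_mk {K : Subgroup G} (hK : MeasurableSet (K : Set G)) (hμ : μ K ≠ ⊤)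
    (F : G ⧸ K → 𝕜) {S : Finset (G ⧸ K)} (hS : Function.support F ⊆ S) :
    ∫ y, F (QuotientGroup.mk y) ∂μ = μ.real K • ∑ q ∈ S, F q := by
  have h : ∀ y : G, F (QuotientGroup.mk y) =
      ∑ q ∈ S, ((QuotientGroup.mk : G → G ⧸ K) ⁻¹' {q}).indicator (fun _ => F q) y :=
    comp_mk_eq_sum_indicator F hS
  simp only [h]
  rw [integral_finsetSum S fun q _ => integrable_indicator_preimage_mk μ hK hμ (F q) q,
    Finset.smul_sum]
  refine Finset.sum_congr rfl fun q _ => ?_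
  rw [integral_indicator_const (F q) (measurableSet_preimage_mk_singleton hK q), measureReal_def,
    measure_preimage_mk_singleton μ K q, measureReal_def]

/-- The same for the coefficient function of an element `t ∈ k[G/K]`:
`∫_G t(mk y) dμ(y) = μ(K) · Σ_q t(q)`. -/
theorem integral_coeff_comp_mk {K : Subgroup G} (hK : MeasurableSet (K : Set G)) (hμ : μ K ≠ ⊤)
    (t : MonoidAlgebra 𝕜 (G ⧸ K)) :
    ∫ y, t.coeff (QuotientGroup.mk y) ∂μ = μ.real K • t.coeff.sum fun _ c => c := by
  rw [Finsupp.sum]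
  exact integral_comp_mk μ hK hμ _ (by rw [Finsupp.fun_support_eq])

/-- THE HAAR CONVOLUTION `(f₁ ⋆ f₂)(x) = ∫_G f₁(y) f₂(y⁻¹x) dμ(y)`. -/
noncomputable def haarConv (f₁ f₂ : G → 𝕜) (x : G) : 𝕜 :=
  ∫ y, f₁ y * f₂ (y⁻¹ * x) ∂μ

omit [MeasurableSpace G] [MeasurableMul G] in
/-- For `K`-invariant `t ∈ k[G/K]` the integrand of the convolution of `s ∘ mk` and `t ∘ mk`
depends only on the coset `yK`: `s(yK) · t(y⁻¹xK) = s(yK) · t((out yK)⁻¹ · xK)`. -/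
theorem coeff_comp_mk_mul_coeff_comp_mk {K : Subgroup G} {t : MonoidAlgebra 𝕜 (G ⧸ K)}
    (ht : t ∈ invariants (Representation.ofMulAction 𝕜 G (G ⧸ K)) K)
    (s : MonoidAlgebra 𝕜 (G ⧸ K)) (x y : G) :
    s.coeff (QuotientGroup.mk y) * t.coeff (QuotientGroup.mk (y⁻¹ * x)) =
      s.coeff (QuotientGroup.mk y) *
        t.coeff ((Quotient.out (QuotientGroup.mk y : G ⧸ K))⁻¹ • (QuotientGroup.mk x : G ⧸ K)) := by
  rw [coeff_inv_out_smul ht, MulAction.Quotient.smul_mk, smul_eq_mul]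

/-- THE HAAR CONVOLUTION OF `K`-BI-INVARIANT FUNCTIONS IS `μ(K)` TIMES THE COUNTING CONVOLUTION:
`((s ∘ mk) ⋆ (t ∘ mk))(x) = μ(K) · (conv t s)(xK)` for `K`-invariant `t` (`K` measurable of finite
measure).  With `μ(K) = 1` this identifies `(C_c(K∖G/K), ⋆)` with `(k[G/K]^K, conv)`, i.e. with
`End_G(k[G/K])` of `T5HeckePermutationModule` (`T5HeckeConvolution.mul_apply_single_one_eq_conv`). -/
theorem haarConv_coeff_comp_mk {K : Subgroup G} (hK : MeasurableSet (K : Set G)) (hμ : μ K ≠ ⊤)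
    {t : MonoidAlgebra 𝕜 (G ⧸ K)}
    (ht : t ∈ invariants (Representation.ofMulAction 𝕜 G (G ⧸ K)) K)
    (s : MonoidAlgebra 𝕜 (G ⧸ K)) (x : G) :
    haarConv μ (fun y => s.coeff (QuotientGroup.mk y)) (fun y => t.coeff (QuotientGroup.mk y)) x =
      μ.real K • (conv t s).coeff (QuotientGroup.mk x) := by
  unfold haarConv
  simp only [coeff_comp_mk_mul_coeff_comp_mk ht s x]
  rw [integral_comp_mk μ hK hμ
    (fun q => s.coeff q * t.coeff ((Quotient.out q)⁻¹ • (QuotientGroup.mk x : G ⧸ K)))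
    (S := s.coeff.support) ?_, coeff_conv, Finsupp.sum]
  intro q hq
  rw [Function.mem_support] at hq
  rw [Finset.mem_coe, Finsupp.mem_support_iff]
  exact left_ne_zero_of_mul hq

/-- With the normalisation `μ(K) = 1`: `(s ∘ mk) ⋆ (t ∘ mk) = (conv t s) ∘ mk`. -/
theorem haarConv_coeff_comp_mk_of_measure_eq_one {K : Subgroup G} (hK : MeasurableSet (K : Set G))
    (hμ : μ K = 1) {t : MonoidAlgebra 𝕜 (G ⧸ K)}
    (ht : t ∈ invariants (Representation.ofMulAction 𝕜 G (G ⧸ K)) K)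
    (s : MonoidAlgebra 𝕜 (G ⧸ K)) (x : G) :
    haarConv μ (fun y => s.coeff (QuotientGroup.mk y)) (fun y => t.coeff (QuotientGroup.mk y)) x =
      (conv t s).coeff (QuotientGroup.mk x) := by
  rw [haarConv_coeff_comp_mk μ hK (by rw [hμ]; exact ENNReal.one_ne_top) ht s x, measureReal_def,
    hμ, ENNReal.toReal_one, one_smul]

/-- THE COMPOSITION IN `H(G, K) = End_G(k[G/K])` IS THE HAAR CONVOLUTION (with `μ(K) = 1`):
`(T ∘ S)(δ_K)(xK) = ((S δ_K ∘ mk) ⋆ (T δ_K ∘ mk))(x)`. -/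
theorem haarConv_apply_single_one {K : Subgroup G} (hK : MeasurableSet (K : Set G))
    (hμ : μ K = 1) (T S : T5HeckePermutationModule.heckeAlgebra 𝕜 K) (x : G) :
    haarConv μ
        (fun y => ((S : Module.End 𝕜 (MonoidAlgebra 𝕜 (G ⧸ K)))
          (MonoidAlgebra.single ((1 : G) : G ⧸ K) (1 : 𝕜))).coeff (QuotientGroup.mk y))
        (fun y => ((T : Module.End 𝕜 (MonoidAlgebra 𝕜 (G ⧸ K)))
          (MonoidAlgebra.single ((1 : G) : G ⧸ K) (1 : 𝕜))).coeff (QuotientGroup.mk y)) x =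
      (((T * S : T5HeckePermutationModule.heckeAlgebra 𝕜 K) :
          Module.End 𝕜 (MonoidAlgebra 𝕜 (G ⧸ K)))
        (MonoidAlgebra.single ((1 : G) : G ⧸ K) (1 : 𝕜))).coeff (QuotientGroup.mk x) := by
  rw [mul_apply_single_one_eq_conv]
  refine haarConv_coeff_comp_mk_of_measure_eq_one μ hK hμ ?_ _ x
  rw [← T5HeckePermutationModule.heckeAlgebraEquivInvariants_apply]
  exact Subtype.coe_prop _

end LeftInvariant

section Haar

variable {G : Type*} [Group G] [TopologicalSpace G] [IsTopologicalGroup G] [MeasurableSpace G]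
  [BorelSpace G] (μ : Measure G) [μ.IsHaarMeasure]

/-- The characteristic function of the double coset `KgK` has Haar integral `#(KgK/K) · μ(K)`
(`K` compact open). -/
theorem integral_indicator_doubleCosetSet {K : Subgroup G} (hopen : IsOpen (K : Set G))
    (hcpt : IsCompact (K : Set G)) (g : G) :
    ∫ y, (doubleCosetSet K g).indicator (fun _ => (1 : ℝ)) y ∂μ =
      ((MulAction.orbit K (g : G ⧸ K)).ncard : ℝ) * μ.real K := by
  have hmeas : MeasurableSet (doubleCosetSet K g) := by
    haveI := T5HeckeDoubleCoset.finite_orbit_coset_of_isOpen_of_isCompact K g hopen hcpt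
    unfold doubleCosetSet
    rw [← Set.biUnion_of_singleton (MulAction.orbit K (g : G ⧸ K)), Set.preimage_iUnion₂]
    exact (Set.toFinite _).measurableSet_biUnion fun q _ =>
      measurableSet_preimage_mk_singleton hopen.measurableSet q
  rw [integral_indicator_const (1 : ℝ) hmeas, smul_eq_mul, mul_one, measureReal_def,
    measure_doubleCosetSet_of_isOpen_of_isCompact μ hopen hcpt g, ENNReal.toReal_mul,
    ENNReal.toReal_natCast, measureReal_def]

end Haar

end Summit.Ventures.HodgeRepro2.T5HaarCosetIntegral
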